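import Summits.Ventures.Crystal3D.Theorems.StickyWulffConstantGenericWallFloorBarlowFamiliesCountApart
import HarnessLib

/-!
# ONE plate's zigzag family is paid, under clause (i) of `FramesApart` alone: `#T₁ ≤ Σ_PAY (12 − deg)`
# (crux `GenericWallFloor`, stmt-Ventures-19480, line `WallLedgerG`; lane T row (e) `stub_residualFaulted`, cf-p1 (lxxxviii)/(xc), K1a file 1
# of HOME/wall-p2-g10/FAULTED-LEDGER-MEMO.md)

HONEST FRAMING. Venture `Summits/Ventures/Crystal3D` (cell `crystal3d-full`), helper `--supports` the crux `GenericWallFloor`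
(stmt-Ventures-19480) of `route-Ventures-StickyWulffConstant`, registered line `WallLedgerG`.  Rung credit only; F-C1 not moved; NOT the
stub.  Inputs BY NAME: E1 (`hsE`, `hcert`), `DoubleStarCoaxialAt` / `CapPairCoaxial` (`hDS`, `hCP`, from `StarPairFar`).

`barlowFamilies_card_le_payers_apart` (`…BarlowFamiliesCountApart`) pays the TWO canonical zigzag families of a Barlow|Barlow cell under the
three clauses of `FramesApart`.  Row (e) of lane T's faulted split (the registered residual) is exactly where the two-sided clauses fail
while ONE well-chosen family is still apart from the passive plate.  This file is the ONE-SIDED count: the bottom plate's family ALONE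
(bottom entry `⟨L₁, v₁, 0⟩`, `v₁` ANY reference upper slot steep for `e₃` — not necessarily `famSlot`), under clause (i) ONLY (no chain
frame of the family carries the top plate's bilayer lattice `L₂·Λ₀` or its basal twin's) — nothing is assumed about the top plate's own
family, no clause (ii)/(iii), no reach set, no registration.  Proof: `bottomFamily_spec_apart` (…BarlowFamiliesApart) fed to lane G's
frame-separated ledger `walkerFamilies_card_le_payers_sep` with an EMPTY second family (its bottom entry `⟨L₁, 0, 0⟩` carries no sound
stack, so every hypothesis about it is vacuous).
* `stackSound_getLast_dir_mem` — the bottom entry of a sound stack has a slot direction;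
* **`barlowFamily_card_le_payers_oneSided`** — `#T₁ ≤ Σ_PAY (12 − deg)` for the bottom plate's window family.
The top plate's version (walkers toward `−e₃`) is the same statement in the flipped presentation (next file, with the window lines).
WHAT THIS IS NOT: not the window LINES, not lane T's `hlines`, not the stub; F-C1 not moved.
-/

noncomputable section

namespace Summit.Ventures.Crystal3D.Theorems

open Finset
open Literature.MathematicalPhysics.StatisticalMechanics
open Summit.Ventures.Crystal3D.Cruxes.TextureLiminf.TexShadow (stacking)
open scoped InnerProductSpace

variable {X : Finset (EuclideanSpace ℝ (Fin 3))}

/-- The bottom entry of a sound stack has its direction in `fccSlots`. -/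
theorem stackSound_getLast_dir_mem (z : EuclideanSpace ℝ (Fin 3)) :
    ∀ (stk : List WalkEntry) (b : WalkEntry), StackSound z stk → stk.getLast? = some b → b.dir ∈ fccSlots
  | [], _, hS, _ => absurd hS (stackSound_nil z)
  | [e], b, hS, hl => by
    have hb : e = b := by simpa using hl
    subst hb
    exact ((stackSound_singleton z e).1 hS).1
  | e :: e' :: rest, b, hS, hl => by
    rw [List.getLast?_cons_cons] at hl
    exact stackSound_getLast_dir_mem z (e' :: rest) b ((stackSound_cons_cons z e e' rest).1 hS).2.2 hl

open scoped Classical in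
/-- **ONE Barlow zigzag family is paid by the payers, under clause (i) of `FramesApart` alone.**  The bottom plate
`(L₁, s₀, σ₁)` (up-presented: the walk data `v₁, canon₁, ms₁, δ₁` of `barlow_lineCount_le_payers_explicit`, `v₁` ANY reference upper slot
with `⟪L₁ v₁, e₃⟫ ≥ √2/2`), the top plate `(L₂, s₂, σ₂)` only as the passive clamped sample, and `hapart₁`: no chain frame of
`chainFrames e₃ L₁ v₁` carries `L₂·Λ₀` or `(twinFrame L₂ (L₂ e₃))·Λ₀`.  Then the window family `T₁` is paid: `#T₁ ≤ Σ_PAY (12 − deg)`. -/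
theorem barlowFamily_card_le_payers_oneSided (hX : ∀ p ∈ X, ∀ q ∈ X, p ≠ q → 1 ≤ dist p q)
    {sE : EuclideanSpace ℝ (Fin 3)} (hsE : sE ∈ fccSlots) (hcert : ExactOnly 0 (fccSlots.filter fun w => 0 < ⟪w, sE⟫_ℝ))
    (hDS : ∀ F₁ F₂ : EuclideanSpace ℝ (Fin 3) ≃ₗᵢ[ℝ] EuclideanSpace ℝ (Fin 3), DoubleStarCoaxialAt F₁ F₂) (hCP : CapPairCoaxial)
    -- the cell
    {σ₁ σ₂ : ℤ → ℤ} (hσ₁ : IsHaggSeq σ₁) (hσ₂ : IsHaggSeq σ₂)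
    (L₁ L₂ : EuclideanSpace ℝ (Fin 3) ≃ₗᵢ[ℝ] EuclideanSpace ℝ (Fin 3)) (s₀ s₂ : EuclideanSpace ℝ (Fin 3))
    (R₀ h ρ : ℝ) (hR₀ : 6 ≤ R₀) (hh : 0 ≤ h) (hρ : 1 ≤ ρ) (P₁ P₂ : Finset (EuclideanSpace ℝ (Fin 3))) (hP₁X : P₁ ⊆ X) (hP₂X : P₂ ⊆ X)
    (hcell : ∀ p ∈ X, -(2 * R₀) ≤ p 2 ∧ p 2 ≤ h + 2 * R₀ ∧ p 0 ^ 2 + p 1 ^ 2 ≤ ρ ^ 2)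
    (hP₁ : ∀ p, p ∈ P₁ ↔ (p ∈ stacking L₁ s₀ σ₁ ∧ -(2 * R₀) ≤ p 2 ∧ p 2 ≤ -R₀ ∧ p 0 ^ 2 + p 1 ^ 2 ≤ ρ ^ 2))
    (hP₂ : ∀ p, p ∈ P₂ ↔ (p ∈ stacking L₂ s₂ σ₂ ∧ h + R₀ ≤ p 2 ∧ p 2 ≤ h + 2 * R₀ ∧ p 0 ^ 2 + p 1 ^ 2 ≤ ρ ^ 2))
    -- bottom walk data (vertical e₃)
    (v₁ : EuclideanSpace ℝ (Fin 3)) (canon₁ : ℤ → EuclideanSpace ℝ (Fin 3) → EuclideanSpace ℝ (Fin 3) × List WalkEntry)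
    (ms₁ : ℤ → EuclideanSpace ℝ (Fin 3))
    (hv₁ : v₁ ∈ fccSlots) (hv₁2 : v₁ 2 = Real.sqrt (2 / 3))
    (hsteep₁ : Real.sqrt 2 / 2 ≤ ⟪L₁ v₁, EuclideanSpace.single (2 : Fin 3) (1 : ℝ)⟫_ℝ)
    (hcanon₁₁ : ∀ m t, σ₁ (m - 1) = 1 → canon₁ m t = (t, [⟨L₁, v₁, 0⟩]))
    (hcanon₁₂ : ∀ m t, σ₁ (m - 1) = -1 → canon₁ m t =
      (t, [⟨twinFrame L₁ (L₁ (EuclideanSpace.single (2 : Fin 3) (1 : ℝ))),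
            bestCapper (twinFrame L₁ (L₁ (EuclideanSpace.single (2 : Fin 3) (1 : ℝ)))) (L₁ (EuclideanSpace.single (2 : Fin 3) (1 : ℝ)))
              (EuclideanSpace.single (2 : Fin 3) (1 : ℝ)),
            L₁ (EuclideanSpace.single (2 : Fin 3) (1 : ℝ))⟩, ⟨L₁, v₁, 0⟩]))
    (hms₁₁ : ∀ m, σ₁ m = 1 → ms₁ m = v₁)
    (hms₁₂ : ∀ m, σ₁ m = -1 → ms₁ m =
      basalMirror (bestCapper (twinFrame L₁ (L₁ (EuclideanSpace.single (2 : Fin 3) (1 : ℝ)))) (L₁ (EuclideanSpace.single (2 : Fin 3) (1 : ℝ)))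
        (EuclideanSpace.single (2 : Fin 3) (1 : ℝ))))
    {δ₁ : ℝ} (hδ₁0 : 0 < δ₁) (hδ₁ : ∀ m, δ₁ ≤ ⟪L₁ (ms₁ m), EuclideanSpace.single (2 : Fin 3) (1 : ℝ)⟫_ℝ)
    -- frames apart from the top plate (clause (i) of `FramesApart`, for THIS family only)
    (hapart₁ : ∀ F ∈ chainFrames (EuclideanSpace.single (2 : Fin 3) (1 : ℝ)) L₁ v₁,
      F '' fccStacking 1 (Real.sqrt (2 / 3)) ≠ L₂ '' fccStacking 1 (Real.sqrt (2 / 3)) ∧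
      F '' fccStacking 1 (Real.sqrt (2 / 3)) ≠
        (twinFrame L₂ (L₂ (EuclideanSpace.single (2 : Fin 3) (1 : ℝ)))) '' fccStacking 1 (Real.sqrt (2 / 3)))
    -- the window family
    (H₁ ρin : ℝ) (hH₁lo : -(2 * R₀) + 2 ≤ H₁) (hH₁hi : H₁ ≤ -R₀ - 3)
    (hρin₁ : ρin + 8 / 3 * (h + 4 * R₀) + ((-R₀ - 2 - H₁) / δ₁ + 2) ≤ ρ - 1)
    {ι₁ : Type*} (T₁ : Finset ι₁) (m₁ a₁ b₁ : ι₁ → ℤ)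
    (hlow₁ : ∀ i ∈ T₁, H₁ ≤ ⟪L₁ (barlowPos 1 (Real.sqrt (2 / 3)) σ₁ (m₁ i) (a₁ i) (b₁ i)) + s₀, EuclideanSpace.single (2 : Fin 3) (1 : ℝ)⟫_ℝ)
    (hpred₁ : ∀ i ∈ T₁, ⟪L₁ (barlowPos 1 (Real.sqrt (2 / 3)) σ₁ (m₁ i) (a₁ i) (b₁ i) - ms₁ (m₁ i - 1)) + s₀,
      EuclideanSpace.single (2 : Fin 3) (1 : ℝ)⟫_ℝ < H₁)
    (hinjT₁ : ∀ i ∈ T₁, ∀ j ∈ T₁,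
      barlowPos 1 (Real.sqrt (2 / 3)) σ₁ (m₁ i) (a₁ i) (b₁ i) = barlowPos 1 (Real.sqrt (2 / 3)) σ₁ (m₁ j) (a₁ j) (b₁ j) → i = j)
    (hlat₁ : ∀ i ∈ T₁, Real.sqrt ((L₁ (barlowPos 1 (Real.sqrt (2 / 3)) σ₁ (m₁ i) (a₁ i) (b₁ i)) + s₀) 0 ^ 2 +
      (L₁ (barlowPos 1 (Real.sqrt (2 / 3)) σ₁ (m₁ i) (a₁ i) (b₁ i)) + s₀) 1 ^ 2) ≤ ρin)
    -- fuel
    {N : ℕ} (hN₁ : ⌈(-R₀ - 2 - H₁) / δ₁⌉₊ + 1 ≤ N) (hN : 8 * (h + 4 * R₀) < 3 * (N : ℝ)) :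
    (T₁.card : ℝ) ≤
      ∑ y ∈ X.filter (fun y => (X.filter fun q => dist y q = 1).card ≠ 12 ∧ -R₀ - 2 ≤ y 2 ∧ y 2 ≤ h + R₀ + 2),
        ((12 : ℝ) - ((X.filter fun q => dist y q = 1).card : ℝ)) := by
  set e₃ : EuclideanSpace ℝ (Fin 3) := EuclideanSpace.single (2 : Fin 3) (1 : ℝ) with he₃
  have he₃n : ‖e₃‖ = 1 := by rw [he₃, PiLp.norm_single, norm_one]
  have hztn : ‖-e₃‖ = 1 := by rw [norm_neg, he₃n]
  have he₃i : ∀ d : EuclideanSpace ℝ (Fin 3), ⟪d, e₃⟫_ℝ = d 2 := fun d => by rw [he₃, EuclideanSpace.inner_single_right]; simp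
  obtain ⟨hB, hinjB⟩ := bottomFamily_spec_apart σ₁ L₁ s₀ v₁ canon₁ ms₁ hσ₁ hX hsE hcert hσ₂ L₂ s₂ R₀ h ρ hR₀ hh hρ P₁ P₂ hP₁X hP₂X hcell
    hP₁ hP₂ hv₁ hv₁2 hsteep₁ hcanon₁₁ hcanon₁₂ hms₁₁ hms₁₂ hδ₁0 hδ₁ hapart₁ H₁ ρin hH₁lo hH₁hi hρin₁ T₁ m₁ a₁ b₁ hlow₁ hpred₁ hinjT₁
    hlat₁ hN₁ hN
  set st₁ : ι₁ → EuclideanSpace ℝ (Fin 3) × List WalkEntry :=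
    fun i => canon₁ (m₁ i) (L₁ (barlowPos 1 (Real.sqrt (2 / 3)) σ₁ (m₁ i) (a₁ i) (b₁ i)) + s₀) with hst₁
  -- the EMPTY second family: bottom entry `⟨L₁, 0, 0⟩` (no sound stack has it), frame set `∅`
  set st₂ : Unit → EuclideanSpace ℝ (Fin 3) × List WalkEntry := fun _ => (0, []) with hst₂
  have hH₁ : ∀ q ∈ X, ⟪q, e₃⟫_ℝ ≤ h + 2 * R₀ := fun q hq => by rw [he₃i]; exact (hcell q hq).2.1
  have hH₂ : ∀ q ∈ X, ⟪q, -e₃⟫_ℝ ≤ 2 * R₀ := fun q hq => by rw [inner_neg_right, he₃i]; linarith [(hcell q hq).1]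
  have hM₁ : ∀ stk : List WalkEntry, StackSound e₃ stk → StackWF e₃ stk → stk.getLast? = some ⟨L₁, v₁, 0⟩ →
      ∀ e ∈ stk, e.frame ∈ chainFrames e₃ L₁ v₁ := fun stk hS hWF hl => frame_mem_chainFrames_of_stack hS hWF hl
  have hM₂ : ∀ stk : List WalkEntry, StackSound (-e₃) stk → StackWF (-e₃) stk → stk.getLast? = some ⟨L₁, 0, 0⟩ →
      ∀ e ∈ stk, e.frame ∈ (∅ : Set (EuclideanSpace ℝ (Fin 3) ≃ₗᵢ[ℝ] EuclideanSpace ℝ (Fin 3))) := by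
    intro stk hS _ hl
    have h0 : (0 : EuclideanSpace ℝ (Fin 3)) ∈ fccSlots := stackSound_getLast_dir_mem (-e₃) stk ⟨L₁, 0, 0⟩ hS hl
    have := norm_eq_one_of_mem_fccSlots h0
    rw [norm_zero] at this
    exact absurd this zero_ne_one
  have hbb : (⟨L₁, v₁, 0⟩ : WalkEntry) ≠ ⟨L₁, 0, 0⟩ := by
    intro hb
    have hv : v₁ = 0 := congrArg WalkEntry.dir hb
    have := norm_eq_one_of_mem_fccSlots hv₁
    rw [hv, norm_zero] at this
    exact zero_ne_one this
  have hsep : ∀ F₁ ∈ chainFrames e₃ L₁ v₁, ∀ F₂ ∈ (∅ : Set (EuclideanSpace ℝ (Fin 3) ≃ₗᵢ[ℝ] EuclideanSpace ℝ (Fin 3))),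
      ¬ ∃ (L : EuclideanSpace ℝ (Fin 3) ≃ₗᵢ[ℝ] EuclideanSpace ℝ (Fin 3)) (t₁ t₂ : EuclideanSpace ℝ (Fin 3)) (σ σ' : ℤ → ℤ),
        IsHaggSeq σ ∧ IsHaggSeq σ' ∧
        F₁ '' fccStacking 1 (Real.sqrt (2 / 3)) ⊆ (fun p => L p + t₁) '' barlowStacking 1 (Real.sqrt (2 / 3)) σ ∧
        F₂ '' fccStacking 1 (Real.sqrt (2 / 3)) ⊆ (fun p => L p + t₂) '' barlowStacking 1 (Real.sqrt (2 / 3)) σ' :=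
    fun _ _ _ hF₂ => absurd hF₂ (Set.notMem_empty _)
  have h := walkerFamilies_card_le_payers_sep hX hsE hcert hDS hCP (chainFrames e₃ L₁ v₁) ∅ hsep he₃n hztn hH₁ hH₂
    T₁ (∅ : Finset Unit) st₁ st₂ hbb N hM₁ hM₂ (fun t ht => ?_) (fun t ht => absurd ht (Finset.notMem_empty _)) hinjB
    (fun t ht => absurd ht (Finset.notMem_empty _)) _ (fun t ht => (hB t ht).2.2.2.2.2)
    (fun t ht => absurd ht (Finset.notMem_empty _))
  · simpa only [Finset.card_empty, Nat.cast_zero, add_zero] using h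
  · obtain ⟨hI, hW, hl, hC, hf, -⟩ := hB t ht
    exact ⟨hI, hW, hl, hC, hf⟩

end Summit.Ventures.Crystal3D.Theorems

end
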